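import Summits.Schanuel.Schanuel.Theorems.RootDecomp1EUntwistedWall03

/-!
# RootDecomp1EUntwistedWall — lens 2, generation 41 «THE UNTWISTED 1-FOLD WALL BY TERM-COUNTING» (lane (P1) of critic RULING L1949 (5); GO + CHECKLIST E-g41 L1993; VERDICT L2040: CLEARED — ONE CELL (E-R18 (a″)) mod hE): `S` ITSELF with surplus one at the UNTWISTED twins `zTwin k β (q·ρ)` (`ρ` hyper-Liouville, `q ∈ ℚ^×`, `β ∈ ℚ(i) ∖ ℚ`, every `k ≥ 1`) and on the whole Gauss-curve class `InGaussCurveClass`, modulo the ONE registered published theorem `hE = EHLM2015_thm_2_1` (Ernvall-Hytönen–Leppälä–Matala-aho 2015, Thm 2.1, typed as a WEAKER few-term consequence over Gaussian-rational exponents) — «count TERMS, not DEGREE» — continuation (RootDecomp1EUntwistedWall04): §10 the twin instances (`wTwin`, `gaussPt_twin`, `linearIndependent_twinMonomials`, `algebraicIndependent_twin`, `succ_le_trdeg_zTwin_untwisted` (2k+1), `schanuel_zTwin_untwisted` (SB (k+k))) + §11 the class `InGaussCurveClass`, `schanuel_inGaussCurveClass`, cells `cell_25020` / `cell_31409` (item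 binders verbatim + one class line), the member `zU = zTwin 2 i λ_H` (`five_le_trdeg_zU`, `four_le_trdeg_zU` mod hE), `not_inPointClass_zU`, `not_inScaleClass_zU`, `not_inTwoScaleClass_zU`, `zU_frame_collides`

(lens-2 g41 HOME kernel UntwistedWall.lean 8d50f5c1…, 1431 l, import tree `RootDecomp1EWallDichotomy01` ONLY; Ctrl 1a8646c2… rc 1 at exactly nine lines C1–C9; Probe 491b1be0…; NODE-g41.md ab32189b…; NODE L2035 / REQUEST L2036 / ERRATUM L2037; writer re-check L2039; critic VERDICT L2040 (crit g8): CLEARED — ONE CELL (E-R18 (a″)) to lens-2, conditional «mod hE»; lens-2 tally cells ×3; RULE E-R19; PORT GO 01–0k `--supports stmt-Schanuel-31409`, statements/proofs verbatim, part 01 docstring of `EHLM2015_thm_2_1` amended by the critic's representation sentence and the `+1 → +2` exponent bookkeeping.)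
PORTED for the decomp-schanuel cell by the census instrument (gen 17), no census credit beyond the cell of record. Split in five parts for the 400-line cap (NODE §7 plan 01–04 with §1–§8 halved): 01 = §1 the registered fact `EHLM2015_thm_2_1` (the ONLY `def … : Prop` binder) + §2–§5 collapse data / identities / Lipschitz bound / distinct exponents and term count; 02 = §6–§8 integrality, sizes, endgame; 03 = §9 THE ENGINE `algebraicIndependent_gaussPt` (+ the kernel's module docstring); 04 = §10–§11 twins, the class `InGaussCurveClass`, the cells `cell_25020` / `cell_31409`, the member `z_U` and its separation from the point / scale / two-scale classes; 05 = §12–§13 the hypothesis-free Diophantine lemma `lambdaH_ne_pow_of_dyadicHyper₂`, `not_inLWClass_zU`, `zU_separation`, and the LIVE-item probes at `z_U`.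
PORT EDITS (statements and proofs otherwise VERBATIM): every undocumented helper received a one-line docstring; the tree-twin one-liners `isAlgebraic_I'`, `I_not_mem_range'`, `lambdaH_transcendental`, `lambdaH_ne_zero'`, `lambdaH_pos'`, `algebraicIndependent_tail'`, `abs_pow_succ_sub_le'` made `private` (copied privately into later parts where used); the two `Iff.rfl` READ-BACKS `defectOneSchanuel_iff` / `eStableDefectOne_iff` of K §13 are NOT re-landed (identical read-backs are already in the tree: `RootDecomp1EGenericScale05.defectOneSchanuel_iff` / `.eStableDefectOne_iff`); the positional probes `item25020_at_zU`, `item31409_at_zU`, `cell_25020_of_defectOneSchanuel`, `eStableDefectOne_at_zU (h : EStableDefectOne)`, `eStableDefectOne_body_at_zU_of_hE` are kept. Items 31409 / 25020 / 31410 stay OPEN (rung 0); nothing here proves `S`.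
-/

noncomputable section

open Complex Polynomial IntermediateField
open scoped BigOperators

open Summit.Schanuel.Schanuel.Theorems.RootDecomp1KHyper (SB SFset exists_ball_eval_ne_zero
  exists_int_mul_eq_map mvaeval_int_map sb_of_algebraicIndependent mem_adjoin_SFset_I')
open Summit.Schanuel.Schanuel.Theorems.RootDecomp1KHyper.HyperCell (HyperLiouville lambdaH
  hyperLiouville_lambdaH hexp one_le_hexp summable_lambdaH)
open Summit.Schanuel.Schanuel.Theorems.RootDecomp1ELWTransport (zTwin zTwin_left zTwin_right
  linearIndependent_zTwin dblMoments InLWClass DyadicHyper₂)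
open Summit.Schanuel.Schanuel.Theorems.RootDecomp1EScaleTransfer (InScaleClass HyperScaleApprox)
open Summit.Schanuel.Schanuel.Theorems.RootDecomp1ETwoScale (CoveredTower InTwoScaleClass)
open Summit.Schanuel.Schanuel.Theorems.RootDecomp1EPointTransfer (InPointClass lambdaH_rat_lower
  lambdaH_sub_rat_lower)
open Summit.Schanuel.Schanuel.Theorems.RootDecomp1EWallDichotomy (InTwistedFrameClass transcendental_complex
  transcendental_of_hyperLiouville not_linearIndependent_zTwin_ratCast twinExpo twinExpo_left twinExpo_right)
open Summit.Schanuel.Schanuel.Theorems.RootDecomp1BHyperFrame (trdeg_adjoin_le_of_isAlgebraic')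
open Summit.Schanuel.Schanuel.Theorems.RootDecomp1BDefectFloorCells (natCast_le_trdeg_of_algebraicIndependent)

namespace Summit.Schanuel.Schanuel.Theorems.RootDecomp1EUntwistedWall

variable {n : ℕ}

/-! ## §10  The twin instances: `S` ITSELF (with surplus one) at `zTwin k β (q·ρ)`, `β ∈ ℚ(i)∖ℚ`, `ρ` hyper-Liouville -/

/-- Gaussian-rational coefficient pattern of `zTwin k (b₁ + b₂ i) (q·ρ)` along `ρ`:
`(q^{j+1}, 0)` on the left block, `(q^{j+1}b₁, q^{j+1}b₂)` on the right block (exponent pattern = tree `twinExpo k`). -/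
def wTwin (k : ℕ) (q b₁ b₂ : ℚ) : Fin (k + k) → ℚ × ℚ :=
  Fin.append (fun j : Fin k => (q ^ ((j : ℕ) + 1), (0 : ℚ)))
    (fun j : Fin k => (q ^ ((j : ℕ) + 1) * b₁, q ^ ((j : ℕ) + 1) * b₂))

/-- Left half of the twin weights: `(q^{j+1}, 0)`. -/
@[simp] theorem wTwin_left (k : ℕ) (q b₁ b₂ : ℚ) (j : Fin k) :
    wTwin k q b₁ b₂ (Fin.castAdd k j) = (q ^ ((j : ℕ) + 1), (0 : ℚ)) := by
  unfold wTwin; rw [Fin.append_left]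

/-- Right half of the twin weights: `(q^{j+1}b₁, q^{j+1}b₂)`. -/
@[simp] theorem wTwin_right (k : ℕ) (q b₁ b₂ : ℚ) (j : Fin k) :
    wTwin k q b₁ b₂ (Fin.natAdd k j) = (q ^ ((j : ℕ) + 1) * b₁, q ^ ((j : ℕ) + 1) * b₂) := by
  unfold wTwin; rw [Fin.append_right]

/-- The Gauss-curve point with the twin weights and exponents IS `zTwin k (b₁ + b₂i) (q·ρ)`, coordinatewise. -/
theorem gι_wTwin_mul_pow (k : ℕ) (q b₁ b₂ : ℚ) (ρ : ℝ) (l : Fin (k + k)) :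
    gι (wTwin k q b₁ b₂ l) * (ρ : ℂ) ^ (twinExpo k l) = zTwin k (gι (b₁, b₂)) ((q : ℝ) * ρ) l := by
  refine Fin.addCases (motive := fun l => gι (wTwin k q b₁ b₂ l) * (ρ : ℂ) ^ (twinExpo k l) =
    zTwin k (gι (b₁, b₂)) ((q : ℝ) * ρ) l) (fun j => ?_) (fun j => ?_) l
  · rw [wTwin_left, twinExpo_left, zTwin_left]
    simp only [gι]; push_cast; ring
  · rw [wTwin_right, twinExpo_right, zTwin_right]
    simp only [gι]; push_cast; ring

/-- The engine tuple of the twin pattern along `ρ` is `(ρ; e^{zTwin k β (qρ)})`. -/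
theorem gaussPt_twin (k : ℕ) (q b₁ b₂ : ℚ) (ρ : ℝ) :
    gaussPt (wTwin k q b₁ b₂) (twinExpo k) (ρ : ℂ) =
      Fin.cons (ρ : ℂ) (cexp ∘ zTwin k (gι (b₁, b₂)) ((q : ℝ) * ρ)) := by
  unfold gaussPt
  congr 1
  funext l
  rw [Function.comp_apply, gι_wTwin_mul_pow]

/-- `gι` is `ℤ`-linear: `z · gι γ = gι (z·γ)`. -/
theorem intCast_mul_gι (z : ℤ) (γ : ℚ × ℚ) : (z : ℂ) * gι γ = gι ((z : ℚ) * γ.1, (z : ℚ) * γ.2) := by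
  simp only [gι]; push_cast; ring

/-- `gι` is additive. -/
theorem gι_add (γ γ' : ℚ × ℚ) : gι (γ + γ') = gι γ + gι γ' := by
  simp only [gι, Prod.fst_add, Prod.snd_add]; push_cast; ring

/-- `gι 0 = 0`. -/
theorem gι_zero : gι 0 = 0 := by simp [gι]

/-- FREENESS of the twin pattern: `q^{j+1}X^{j+1}`, `q^{j+1}(b₁ + b₂ i)X^{j+1}` (`j < k`) are `ℤ`-free in `ℂ[X]`
when `q ≠ 0` and `b₂ ≠ 0` (read the `X^{j+1}`-coefficient in `ℚ(i) ≅ ℚ × ℚ`: second, then first component). -/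
theorem linearIndependent_twinMonomials (k : ℕ) {q : ℚ} (hq : q ≠ 0) (b₁ : ℚ) {b₂ : ℚ} (hb₂ : b₂ ≠ 0) :
    LinearIndependent ℤ (fun l : Fin (k + k) => Polynomial.monomial (twinExpo k l) (gι (wTwin k q b₁ b₂ l))) := by
  classical
  refine Fintype.linearIndependent_iff.mpr fun g hg => ?_
  have hcoef : ∀ j : Fin k, ((g (Fin.castAdd k j) : ℂ) * gι (q ^ ((j : ℕ) + 1), (0 : ℚ)) +
      (g (Fin.natAdd k j) : ℂ) * gι (q ^ ((j : ℕ) + 1) * b₁, q ^ ((j : ℕ) + 1) * b₂)) = 0 := by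
    intro j
    have h := congrArg (fun p : ℂ[X] => p.coeff ((j : ℕ) + 1)) hg
    simp only [Fin.sum_univ_add, Polynomial.coeff_add, Polynomial.finsetSum_coeff, zsmul_eq_mul,
      ← Polynomial.C_eq_intCast, Polynomial.coeff_C_mul, Polynomial.coeff_monomial, wTwin_left, wTwin_right,
      twinExpo_left, twinExpo_right, Polynomial.coeff_zero, mul_ite, mul_zero, add_left_inj, Fin.val_inj,
      Finset.sum_ite_eq', Finset.mem_univ, if_true] at h
    exact h
  have hpair : ∀ j : Fin k, ((g (Fin.castAdd k j) : ℚ) * q ^ ((j : ℕ) + 1) +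
      (g (Fin.natAdd k j) : ℚ) * (q ^ ((j : ℕ) + 1) * b₁), (g (Fin.castAdd k j) : ℚ) * 0 +
      (g (Fin.natAdd k j) : ℚ) * (q ^ ((j : ℕ) + 1) * b₂)) = (0 : ℚ × ℚ) := by
    intro j
    have h := hcoef j
    rw [intCast_mul_gι, intCast_mul_gι, ← gι_add, ← gι_zero] at h
    have h' := gι_injective h
    simpa only [Prod.mk_add_mk] using h'
  have hqp : ∀ j : Fin k, q ^ ((j : ℕ) + 1) ≠ 0 := fun j => pow_ne_zero _ hq
  have hnat : ∀ j : Fin k, g (Fin.natAdd k j) = 0 := by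
    intro j
    have h := congrArg Prod.snd (hpair j)
    simp only [mul_zero, zero_add, Prod.snd_zero, mul_eq_zero, Int.cast_eq_zero, hqp j, hb₂, or_false] at h
    exact h
  have hcast : ∀ j : Fin k, g (Fin.castAdd k j) = 0 := by
    intro j
    have h := congrArg Prod.fst (hpair j)
    simp only [hnat j, Int.cast_zero, zero_mul, add_zero, Prod.fst_zero, mul_eq_zero, Int.cast_eq_zero, hqp j,
      or_false] at h
    exact h
  intro l
  exact Fin.addCases (motive := fun l => g l = 0) hcast hnat l

/-- **ENGINE, twin form: `(ρ; e^{zTwin k β (qρ)})` is algebraically free** (`2k + 1` numbers) — mod `hE`. -/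
theorem algebraicIndependent_twin (hE : EHLM2015_thm_2_1) {ρ : ℝ} (hρ : HyperLiouville ρ) (k : ℕ) {q : ℚ}
    (hq : q ≠ 0) (b₁ : ℚ) {b₂ : ℚ} (hb₂ : b₂ ≠ 0) :
    AlgebraicIndependent ℚ (Fin.cons (ρ : ℂ) (cexp ∘ zTwin k (gι (b₁, b₂)) ((q : ℝ) * ρ)) :
      Fin (k + k + 1) → ℂ) := by
  rw [← gaussPt_twin]
  exact algebraicIndependent_gaussPt hE hρ _ _ (linearIndependent_twinMonomials k hq b₁ hb₂)

/-- The tail of an algebraically independent `Fin.cons` family is algebraically independent. -/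
private theorem algebraicIndependent_tail' {n : ℕ} {x : ℂ} {f : Fin n → ℂ}
    (h : AlgebraicIndependent ℚ (Fin.cons x f : Fin (n + 1) → ℂ)) : AlgebraicIndependent ℚ f := by
  have := h.comp Fin.succ (Fin.succ_injective n)
  have e : ((Fin.cons x f : Fin (n + 1) → ℂ) ∘ Fin.succ) = f := by
    funext j; simp [Fin.cons_succ]
  rwa [e] at this

set_option synthInstance.maxHeartbeats 200000 in
/-- **S WITH SURPLUS ONE at the untwisted twins**: `2k + 1 ≤ trdeg_ℚ ℚ(z, e^z)` for `z = zTwin k β (qρ)`,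
`k ≥ 1`, `β = b₁ + b₂ i ∈ ℚ(i) ∖ ℚ` (`b₂ ≠ 0`), `q ∈ ℚ^×`, `ρ` hyper-Liouville — mod `hE`
(`ρ = q⁻¹ z_{(0)}` is algebraic over `ℚ(z, e^z)`, so all `2k+1` free numbers count). -/
theorem succ_le_trdeg_zTwin_untwisted (hE : EHLM2015_thm_2_1) {ρ : ℝ} (hρ : HyperLiouville ρ) {k : ℕ}
    (hk : 0 < k) {q : ℚ} (hq : q ≠ 0) (b₁ : ℚ) {b₂ : ℚ} (hb₂ : b₂ ≠ 0) :
    ((k + k + 1 : ℕ) : Cardinal) ≤ Algebra.trdeg ℚ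
      ↥(IntermediateField.adjoin ℚ (Set.range (zTwin k (gι (b₁, b₂)) ((q : ℝ) * ρ)) ∪
        Set.range (cexp ∘ zTwin k (gι (b₁, b₂)) ((q : ℝ) * ρ)))) := by
  set z : Fin (k + k) → ℂ := zTwin k (gι (b₁, b₂)) ((q : ℝ) * ρ) with hz
  set L : IntermediateField ℚ ℂ := IntermediateField.adjoin ℚ (Set.range z ∪ Set.range (cexp ∘ z)) with hL
  have hai := algebraicIndependent_twin hE hρ k hq b₁ hb₂
  have h1 : ((k + k + 1 : ℕ) : Cardinal) ≤ Algebra.trdeg ℚ ↥(IntermediateField.adjoin ℚ (Set.range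
      (Fin.cons (ρ : ℂ) (cexp ∘ z) : Fin (k + k + 1) → ℂ))) :=
    natCast_le_trdeg_of_algebraicIndependent hai fun i => IntermediateField.subset_adjoin ℚ _ ⟨i, rfl⟩
  refine h1.trans (trdeg_adjoin_le_of_isAlgebraic' L ?_)
  rintro x ⟨i, rfl⟩
  refine Fin.cases ?_ (fun j => ?_) i
  · rw [Fin.cons_zero]
    have hz0 : z (Fin.castAdd k ⟨0, hk⟩) = (q : ℂ) * (ρ : ℂ) := by
      rw [hz, zTwin_left]; push_cast; ring
    have hmem : (q : ℂ) * (ρ : ℂ) ∈ L := by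
      rw [← hz0]; exact IntermediateField.subset_adjoin ℚ _ (Or.inl ⟨_, rfl⟩)
    have hρeq : (ρ : ℂ) = ((q : ℂ) * (ρ : ℂ)) * ((q : ℂ))⁻¹ := by
      rw [mul_comm ((q : ℂ) * _), ← mul_assoc, inv_mul_cancel₀ (by exact_mod_cast hq), one_mul]
    rw [hρeq]
    refine (isAlgebraic_algebraMap (⟨_, hmem⟩ : ↥L)).mul ?_
    have hqalg : IsAlgebraic ℚ ((q : ℂ)) := by
      have : (q : ℂ) = algebraMap ℚ ℂ q := (eq_ratCast _ q).symm
      rw [this]; exact isAlgebraic_algebraMap q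
    exact (hqalg.tower_top (↥L)).inv
  · rw [Fin.cons_succ]
    exact isAlgebraic_algebraMap (⟨_, IntermediateField.subset_adjoin ℚ _ (Or.inr ⟨j, rfl⟩)⟩ : ↥L)

/-- **S ITSELF at the untwisted twins** (`SB (2k) (zTwin k β (qρ))`: `2k ≤ trdeg`) — mod `hE`; all `k`. -/
theorem schanuel_zTwin_untwisted (hE : EHLM2015_thm_2_1) {ρ : ℝ} (hρ : HyperLiouville ρ) (k : ℕ) {q : ℚ}
    (hq : q ≠ 0) (b₁ : ℚ) {b₂ : ℚ} (hb₂ : b₂ ≠ 0) : SB (k + k) (zTwin k (gι (b₁, b₂)) ((q : ℝ) * ρ)) := by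
  have hai := algebraicIndependent_tail' (algebraicIndependent_twin hE hρ k hq b₁ hb₂)
  refine sb_of_algebraicIndependent hai (by simp) fun l => ?_
  exact mem_adjoin_SFset_I' (Or.inr ⟨l, rfl⟩)

/-! ## §11  THE CLASS, the CELLS of the live 1E items on it, the explicit MEMBER and its separation -/

/-- **`InGaussCurveClass z` — THE CELL LINE (one class line).** `z_l = w_l · T^{e_l}` with `w_l ∈ ℚ(i)`
(`w_l` read as `w_l.1 + w_l.2 i`), `e_l ∈ ℕ`, along ONE hyper-Liouville parameter `T`, the monomials
`w_l X^{e_l}` being `ℤ`-free in `ℂ[X]`.  Contains every `zTwin k β (q·ρ)` (`β ∈ ℚ(i)∖ℚ`, `q ∈ ℚ^×`,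
`ρ ∈ HyperLiouville`, all `k`). -/
def InGaussCurveClass {n : ℕ} (z : Fin n → ℂ) : Prop :=
  ∃ (T : ℝ) (w : Fin n → ℚ × ℚ) (e : Fin n → ℕ), HyperLiouville T ∧
    LinearIndependent ℤ (fun l : Fin n => Polynomial.monomial (e l) (gι (w l))) ∧
    ∀ l, z l = gι (w l) * (T : ℂ) ^ (e l)

/-- **CELL THEOREM — `S` ITSELF on the class, at every length `n`** (mod `hE`): the `n` exponentials alone are
algebraically independent. -/
theorem schanuel_inGaussCurveClass (hE : EHLM2015_thm_2_1) (n : ℕ) (z : Fin n → ℂ)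
    (hz : InGaussCurveClass z) : SB n z := by
  obtain ⟨T, w, e, hT, hLI, hz⟩ := hz
  have hai : AlgebraicIndependent ℚ (gaussPt w e (T : ℂ) ∘ Fin.succ) :=
    (algebraicIndependent_gaussPt hE hT w e hLI).comp _ (Fin.succ_injective n)
  refine sb_of_algebraicIndependent hai (by simp) fun l => ?_
  refine mem_adjoin_SFset_I' (Or.inr ⟨l, ?_⟩)
  rw [Function.comp_apply, Function.comp_apply, hz l, gaussPt_succ]

/-- Every untwisted twin `zTwin k (b₁ + b₂i) (q·ρ)` with `q ≠ 0`, `b₂ ≠ 0`, `ρ` hyper-Liouville lies in the Gauss-curve class. -/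
theorem zTwin_mem_gaussCurveClass {ρ : ℝ} (hρ : HyperLiouville ρ) (k : ℕ) {q : ℚ} (hq : q ≠ 0) (b₁ : ℚ)
    {b₂ : ℚ} (hb₂ : b₂ ≠ 0) : InGaussCurveClass (zTwin k (gι (b₁, b₂)) ((q : ℝ) * ρ)) :=
  ⟨ρ, wTwin k q b₁ b₂, twinExpo k, hρ, linearIndependent_twinMonomials k hq b₁ hb₂,
    fun l => (gι_wTwin_mul_pow k q b₁ b₂ ρ l).symm⟩

/-- **CELL of item 25020 `DefectOneSchanuel`** — binders verbatim, ONE class line `InGaussCurveClass z`;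
one line from `S` itself on the class (mod `hE`). -/
theorem cell_25020 (hE : EHLM2015_thm_2_1) : ∀ (n : ℕ) (z : Fin n → ℂ), LinearIndependent ℚ z →
    InGaussCurveClass z →
      (n : Cardinal) ≤ Algebra.trdeg ℚ
        ↥(IntermediateField.adjoin ℚ (Set.range z ∪ Set.range (Complex.exp ∘ z))) + 1 :=
  fun n z _ hcl => (schanuel_inGaussCurveClass hE n z hcl).trans le_self_add

/-- **CELL of item 31409 `EStableDefectOne`** — binders verbatim (E-stability and the first-failure
hypothesis CARRIED, not consumed), ONE class line `InGaussCurveClass z` (mod `hE`). -/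
theorem cell_31409 (hE : EHLM2015_thm_2_1) : ∀ (n : ℕ) (z : Fin n → ℂ), LinearIndependent ℚ z →
    (∃ β : ℂ, IsAlgebraic ℚ β ∧ β ∉ Set.range (algebraMap ℚ ℂ) ∧
      ∀ i, β * z i ∈ Submodule.span ℚ (Set.range z)) →
    (∀ (m : ℕ) (w : Fin m → ℂ), m < n → LinearIndependent ℚ w →
      (∀ j, w j ∈ Submodule.span ℚ (Set.range z)) →
        (m : Cardinal) ≤ Algebra.trdeg ℚ
          ↥(IntermediateField.adjoin ℚ (Set.range w ∪ Set.range (Complex.exp ∘ w))) + 1) →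
    InGaussCurveClass z →
      (n : Cardinal) ≤ Algebra.trdeg ℚ
        ↥(IntermediateField.adjoin ℚ (Set.range z ∪ Set.range (Complex.exp ∘ z))) + 1 :=
  fun n z hli _ _ hcl => cell_25020 hE n z hli hcl

/-- **THE EXPLICIT MEMBER** `z_U = (λ_H, λ_H², iλ_H, iλ_H²) = zTwin 2 i λ_H` (untwisted: the scale `λ_H` is itself
hyper-Liouville; `β = i`, `q = 1`). -/
def zU : Fin (2 + 2) → ℂ := zTwin 2 I lambdaH

/-- `gι (0, 1) = i`. -/
theorem gι_zero_one : gι ((0 : ℚ), (1 : ℚ)) = I := by simp [gι]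

/-- `z_U` as an untwisted twin with `q = 1`, `β = i`, parameter `λ_H`. -/
theorem zU_eq : zU = zTwin 2 (gι ((0 : ℚ), (1 : ℚ))) ((((1 : ℚ) : ℝ)) * lambdaH) := by
  rw [zU, gι_zero_one]; push_cast; rw [one_mul]

/-- The member `z_U` lies in the Gauss-curve class (`λ_H` is hyper-Liouville, tree). -/
theorem zU_mem_gaussCurveClass : InGaussCurveClass zU := by
  rw [zU_eq]; exact zTwin_mem_gaussCurveClass hyperLiouville_lambdaH 2 one_ne_zero 0 one_ne_zero

/-- **`S` with surplus at `z_U`: `5 ≤ trdeg ℚ(z_U, e^{z_U})`** — mod `hE` only. -/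
theorem five_le_trdeg_zU (hE : EHLM2015_thm_2_1) :
    ((5 : ℕ) : Cardinal) ≤ Algebra.trdeg ℚ
      ↥(IntermediateField.adjoin ℚ (Set.range zU ∪ Set.range (cexp ∘ zU))) := by
  rw [zU_eq]
  exact succ_le_trdeg_zTwin_untwisted hE hyperLiouville_lambdaH (k := 2) (by norm_num) one_ne_zero 0
    one_ne_zero

/-- **`S` at `z_U`** (`SB 4 z_U`: `4 ≤ trdeg`) — mod `hE` only. -/
theorem four_le_trdeg_zU (hE : EHLM2015_thm_2_1) : SB (2 + 2) zU :=
  schanuel_inGaussCurveClass hE _ zU zU_mem_gaussCurveClass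

/-- The four coordinates of `z_U`: `(λ_H, λ_H², iλ_H, iλ_H²)`. -/
theorem zU_apply : zU (Fin.castAdd 2 0) = (lambdaH : ℂ) ∧ zU (Fin.castAdd 2 1) = (lambdaH : ℂ) ^ 2 ∧
    zU (Fin.natAdd 2 0) = I * (lambdaH : ℂ) ∧ zU (Fin.natAdd 2 1) = I * (lambdaH : ℂ) ^ 2 := by
  refine ⟨?_, ?_, ?_, ?_⟩
  · rw [zU, zTwin_left]; simp
  · rw [zU, zTwin_left]; simp
  · rw [zU, zTwin_right]; simp
  · rw [zU, zTwin_right]; simp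

/-- `λ_H` is transcendental (tree: hyper-Liouville ⇒ transcendental; private copy in `ℂ`). -/
private theorem lambdaH_transcendental : Transcendental ℚ (lambdaH : ℂ) :=
  transcendental_complex (transcendental_of_hyperLiouville hyperLiouville_lambdaH)

/-- `(λ_H : ℂ) ≠ 0`. -/
private theorem lambdaH_ne_zero' : (lambdaH : ℂ) ≠ 0 := fun h =>
  lambdaH_transcendental (by rw [h]; exact isAlgebraic_zero)

/-- Ratio trick: `x = ξ y₀`, `x² = ξ y₁`, `x ≠ 0` ⇒ `x·y₀ = y₁`. -/
theorem mul_eq_of_scale {x ξ y₀ y₁ : ℂ} (hx : x ≠ 0) (e0 : x = ξ * y₀) (e1 : x ^ 2 = ξ * y₁) :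
    x * y₀ = y₁ := by
  have hξ : ξ ≠ 0 := by rintro rfl; exact hx (by rw [e0, zero_mul])
  have h : ξ * (x * y₀) = ξ * y₁ := by
    rw [← e1, sq]; nth_rewrite 2 [e0]; ring
  exact mul_left_cancel₀ hξ h

/-- **`z_U ∉ InPointClass`** (g36; copy `RootDecomp1EPointTransfer.InPointClass`, as g40 §5): `z_U₁/z_U₀ = λ_H`
would be a ratio of algebraic numbers. -/
theorem not_inPointClass_zU : ¬ InPointClass zU := by
  rintro ⟨ρ, y, -, hyalg, -, hz⟩
  obtain ⟨h0, h1, -, -⟩ := zU_apply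
  have e0 : (lambdaH : ℂ) = (ρ : ℂ) * y (Fin.castAdd 2 0) := by rw [← h0, hz]
  have e1 : (lambdaH : ℂ) ^ 2 = (ρ : ℂ) * y (Fin.castAdd 2 1) := by rw [← h1, hz]
  have key := mul_eq_of_scale lambdaH_ne_zero' e0 e1
  have hy0 : y (Fin.castAdd 2 0) ≠ 0 := by
    intro h; rw [h, mul_zero] at e0; exact lambdaH_ne_zero' e0
  have eT : (lambdaH : ℂ) = y (Fin.castAdd 2 1) * (y (Fin.castAdd 2 0))⁻¹ := by
    rw [← key, mul_inv_cancel_right₀ hy0]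
  exact lambdaH_transcendental (by rw [eT]; exact (hyalg _).mul (hyalg _).inv)

/-- **`z_U ∉ InScaleClass`** (g35; copy `RootDecomp1EScaleTransfer.InScaleClass`, as g40 §5): at level `0`
the tuple `γ·y` is algebraic, so again `z_U₁/z_U₀ = λ_H` would be algebraic. -/
theorem not_inScaleClass_zU : ¬ InScaleClass zU := by
  rintro ⟨D, ω, y, ξ, hωalg, -, hξ, hz⟩
  obtain ⟨γ, M, hγ, hγy, -⟩ := hξ 0
  have halg : ∀ j, IsAlgebraic ℚ (γ * y j) := by
    intro j
    rw [hγy j]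
    refine IsIntegral.isAlgebraic (IsIntegral.sum _ fun i _ => ?_)
    exact ((isAlgebraic_int (M i j)).isIntegral).mul (hωalg i).isIntegral
  obtain ⟨h0, h1, -, -⟩ := zU_apply
  have e0 : (lambdaH : ℂ) = ξ * y (Fin.castAdd 2 0) := by rw [← h0, hz]
  have e1 : (lambdaH : ℂ) ^ 2 = ξ * y (Fin.castAdd 2 1) := by rw [← h1, hz]
  have key := mul_eq_of_scale lambdaH_ne_zero' e0 e1
  have hy0 : γ * y (Fin.castAdd 2 0) ≠ 0 := by
    refine mul_ne_zero hγ ?_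
    intro h; rw [h, mul_zero] at e0; exact lambdaH_ne_zero' e0
  have eT : (lambdaH : ℂ) = (γ * y (Fin.castAdd 2 1)) * (γ * y (Fin.castAdd 2 0))⁻¹ := by
    rw [← key, show γ * ((lambdaH : ℂ) * y (Fin.castAdd 2 0)) = (lambdaH : ℂ) * (γ * y (Fin.castAdd 2 0)) by ring,
      mul_inv_cancel_right₀ hy0]
  exact lambdaH_transcendental (by rw [eT]; exact (halg _).mul (halg _).inv)

/-- **`z_U ∉ InTwoScaleClass`** (g37; copy `RootDecomp1ETwoScale.InTwoScaleClass`, as g40 §5): matching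
`z_U = (T, βT, σ, βσ)` forces `β = z_U₁/z_U₀ = λ_H`, which is not algebraic. -/
theorem not_inTwoScaleClass_zU : ¬ InTwoScaleClass zU := by
  rintro ⟨T, σ, β, -, hT0, -, hβalg, -, hz⟩
  obtain ⟨h0, h1, -, -⟩ := zU_apply
  have e0 : (lambdaH : ℂ) = (T : ℂ) := by rw [← h0, hz]; rfl
  have e1 : (lambdaH : ℂ) ^ 2 = β * (T : ℂ) := by rw [← h1, hz]; rfl
  have hTC : (T : ℂ) ≠ 0 := Complex.ofReal_ne_zero.mpr hT0
  have eβ : β = (lambdaH : ℂ) := by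
    have : β * (T : ℂ) = (lambdaH : ℂ) * (T : ℂ) := by rw [← e1, sq, e0]
    exact mul_right_cancel₀ hTC this
  exact lambdaH_transcendental (eβ ▸ hβalg)

/-- **Engine-level separation from g40's twisted frames**: writing the scale of `z_U` as `T = θ·ρ` with `θ = 1`
(`ρ = λ_H`), the algebraic twin `zTwin 2 β θ` is `ℚ`-DEPENDENT (tree `not_linearIndependent_zTwin_ratCast`), so the
frame engine `schanuel_zTwin_of_twisted` (mod `hRoy`) is silent on `z_U` through this representation. -/
theorem zU_frame_collides (β : ℂ) : ¬ LinearIndependent ℚ (zTwin 2 β (((1 : ℚ) : ℝ))) :=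
  not_linearIndependent_zTwin_ratCast (le_refl 2) β 1

end Summit.Schanuel.Schanuel.Theorems.RootDecomp1EUntwistedWall
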